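import Summits.QuantumFields.BalabanUV.Beta.GAN24.TaylorBlockSum
import Literature.MathematicalPhysics.QuantumFieldTheory.Balaban1983to89.Beta.KernelWard

/-!
# `BalabanUV.Beta.GAN24.Push4TwoRate` — binder row G-an2-4 ∕ (CONV-C), W-slot road «W3» (SKELETON-W3 v0.2 §7.3 (T-marg)),
# journal INTENT «W3-TMARG-CORE*» PART 1 of 2: THE TWO-RATE LATTICE-SUM BRICKS behind the marginal transport of the four-leg push

NOT IN PRINT; OUR BOOKKEEPING ([folklore] elementary real analysis on `ℤ^{d+1}`; G-an2-4 formalisation swarm, leaf prover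
`b2b-balaban-gan24-formalise-leaf-03`, gen 17).  HONEST FRAMING (cell contract, verbatim): «discharging `BetaPertH` makes Bałaban's UV
stability UNCONDITIONAL — a real constructive-QFT result; it is NOT the continuum limit and NOT the Clay problem.»  HONEST DEPENDENCY
(verbatim): «continuum YM on T⁴ ⇐ BetaPertH ∧ nine spine estimates (0/9 proved); BetaPertH ⇐ (D1) ∧ (D4) ∧ CAP+tail; G-an2-4 gates
asym, D1 and NE2/3/4.»

WHAT.  The located obstruction of the W-slot (SKELETON-W3 §1.4; leaf-02-g14 l.7060, leaf-14-g21 l.6956) is that an2's one-rate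
localisation bricks (`BalabanCompositeJets.biLoc_wsum_far` ∕ `_two`) sum a weighted superposition AT THE WEIGHT'S RATE: for the legs of
a COMPOSITE push over `k` levels (relative blocking `L = Lc^k`) that rate is `∼ 1/L` and each of the three inner sums would cost a
lattice constant `∼ L^{d+1}`.  The bricks below sum instead AT THE TABLE'S OWN RATE `δ` (fine units, free of `L`) and let the legs enter
by their SUP and their BLOCK-LABEL decay `e^{−m|quo L · − c|₁}` only:
* §1 `abs_ediv_sub_ediv_le_abs_sub`, **`l1_quo_sub_quo_le_l1`** — Euclidean division by `L ≥ 1` is 1-Lipschitz, so the block label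
  `quo L` is `ℓ¹`-1-Lipschitz (the sharp form of leaf-04's `TaylorBlockSum.l1_quo_sub_quo_le`, no `+ D`).
* §2 **`exp_two_rate_le`** ∕ `summable_two_rate` ∕ **`tsum_two_rate_le`** — THE TWO-RATE SUM:
  `Σ'_v e^{−m|quo L v − c|₁}·e^{−δ|v − u|₁} ≤ Zl_{d+1}(δ/2)·e^{−η|quo L u − c|₁}`, `η := min m (δ/2)` (half of the table's decay sums,
  the other half carries the block label of `v` to that of `u`).
* §3 **`abs_tsum_leg_le`** — LEG AGAINST KERNEL (swap + two-rate): if `|F x| ≤ A·e^{−m|quo L x − c|₁}·Σ'_u ψ u·e^{−δ|x − u|₁}` with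
  `ψ ≥ 0` summable, then `|Σ'_x F x| ≤ A·Zl_{d+1}(δ/2)·Σ'_u ψ u·e^{−η|quo L u − c|₁}`; the order swap is `KernelWard.tsum_comm_of_prodBound`
  with the product majorant obtained by DROPPING the cross factor `e^{−δ|x−u|₁} ≤ 1`.
* §4 **`exp_four_le`** ∕ **`tsum_block_four_le`** — THE ONE FREE BLOCK SUM: `Σ'_u e^{−m|quo L u − y|₁}·Π_{c ∈ {y′,x′,z′}} e^{−η|quo L u − c|₁}
  ≤ L^{d+1}·Zl_{d+1}(m/4)·e^{−τ|y′ − y|₁}·e^{−τ(|x′ − y|₁ + |z′ − y|₁)}`, `τ := min (m/4) (δ/2)` (leaf-04's `tsum_comp_quo`: each block has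
  `L^{d+1}` points) — the ONLY place a power of `L` appears.
Part 2 (`GAN24/Push4Locality`) feeds these into leaf-17's `Push4.push₄`.  Nothing is cited, no `def … : Prop` is minted, no object of
an2's typed system occurs; NOT the row (T-marg), NOT (T-irr); discharges NOTHING of «T2Shape»∕«T2SupRate»∕(hW, hWall); 0∕2 wall binders;
NOT «W-slot closed», NEVER «G-an2-4 closed»; NOT BetaPertH, NOT continuum, NOT Clay.
-/

noncomputable section

open Finset
open scoped BigOperators
open Literature.MathematicalPhysics.QuantumFieldTheory
open Literature.MathematicalPhysics.QuantumFieldTheory.Balaban1983to89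
open Literature.MathematicalPhysics.QuantumFieldTheory.Balaban1983to89.Beta
open B12Sec2to5 (l1 l1_nonneg)
open ExpKernelCalculus (Zl Zl_nonneg summable_exp_shift summable_exp_shift' tsum_exp_shift tsum_exp_shift' l1_sub_triangle
  l1_sub_symm)
open KernelWard (ProdBound tsum_comm_of_prodBound)
open LatticeForm (quo)
open Summit.QuantumFields.BalabanUV.Beta.GAN24.TaylorBlockSum (summable_comp_quo tsum_comp_quo)

namespace Summit.QuantumFields.BalabanUV.Beta.GAN24.Push4TwoRate

variable {d : ℕ}

/-! ## §1 The block label is `ℓ¹`-1-Lipschitz -/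

/-- [folklore] Euclidean division by `L ≥ 1` is 1-Lipschitz on `ℤ`: `|a / L − b / L| ≤ |a − b|` (monotone, and `(c + k)/L ≤ c/L + k`
for `k ≥ 0`). -/
theorem abs_ediv_sub_ediv_le_abs_sub {L : ℕ} (hL : 1 ≤ L) (a b : ℤ) :
    |a / (L : ℤ) - b / (L : ℤ)| ≤ |a - b| := by
  have hL0 : (0 : ℤ) < L := by exact_mod_cast hL
  have hLne : (L : ℤ) ≠ 0 := hL0.ne'
  have step : ∀ c k : ℤ, 0 ≤ k → (c + k) / (L : ℤ) ≤ c / (L : ℤ) + k := by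
    intro c k hk
    have h1 : c + k ≤ c + k * (L : ℤ) := by nlinarith
    calc (c + k) / (L : ℤ) ≤ (c + k * (L : ℤ)) / (L : ℤ) := Int.ediv_le_ediv hL0 h1
      _ = c / (L : ℤ) + k := by rw [Int.add_mul_ediv_right _ _ hLne]
  rcases le_total a b with hab | hab
  · have hmono : a / (L : ℤ) ≤ b / (L : ℤ) := Int.ediv_le_ediv hL0 hab
    have hup : b / (L : ℤ) ≤ a / (L : ℤ) + (b - a) := by
      have h := step a (b - a) (by linarith)
      rwa [show a + (b - a) = b by ring] at h
    rw [abs_of_nonpos (by linarith), abs_of_nonpos (by linarith)]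
    linarith
  · have hmono : b / (L : ℤ) ≤ a / (L : ℤ) := Int.ediv_le_ediv hL0 hab
    have hup : a / (L : ℤ) ≤ b / (L : ℤ) + (a - b) := by
      have h := step b (a - b) (by linarith)
      rwa [show b + (a - b) = a by ring] at h
    rw [abs_of_nonneg (by linarith), abs_of_nonneg (by linarith)]
    linarith

/-- [folklore] **THE BLOCK LABEL IS `ℓ¹`-1-LIPSCHITZ**: `|quo L w − quo L u|₁ ≤ |w − u|₁` for `L ≥ 1`. -/
theorem l1_quo_sub_quo_le_l1 {L : ℕ} (hL : 1 ≤ L) (w u : Fin (d + 1) → ℤ) :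
    l1 (quo L w - quo L u) ≤ l1 (w - u) := by
  unfold l1
  refine Finset.sum_le_sum fun i _ => ?_
  have h := abs_ediv_sub_ediv_le_abs_sub hL (w i) (u i)
  have h' : |((w i / (L : ℤ) - u i / (L : ℤ) : ℤ) : ℝ)| ≤ |((w i - u i : ℤ) : ℝ)| := by
    rw [← Int.cast_abs, ← Int.cast_abs]; exact_mod_cast h
  simpa only [quo, Pi.sub_apply, Int.cast_sub] using h'

/-! ## §2 The two-rate sum -/

/-- [folklore] **TWO-RATE POINTWISE BOUND**: with `η := min m (δ/2)`,
`e^{−m|quo L v − c|₁}·e^{−δ|v − u|₁} ≤ e^{−(δ/2)|v − u|₁}·e^{−η|quo L u − c|₁}` — half of the fine decay is kept for summation, the other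
half moves the block label from `v` to `u` (`|quo L v − quo L u|₁ ≤ |v − u|₁`) and joins the leg through the triangle inequality. -/
theorem exp_two_rate_le {L : ℕ} (hL : 1 ≤ L) {m δ : ℝ} (hm : 0 ≤ m) (hδ : 0 ≤ δ) (v u c : Fin (d + 1) → ℤ) :
    Real.exp (-m * l1 (quo L v - c)) * Real.exp (-δ * l1 (v - u))
      ≤ Real.exp (-(δ / 2) * l1 (v - u)) * Real.exp (-(min m (δ / 2)) * l1 (quo L u - c)) := by
  rw [← Real.exp_add, ← Real.exp_add, Real.exp_le_exp]
  have hq : l1 (quo L v - quo L u) ≤ l1 (v - u) := l1_quo_sub_quo_le_l1 hL v u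
  have htri : l1 (quo L u - c) ≤ l1 (quo L u - quo L v) + l1 (quo L v - c) := l1_sub_triangle _ _ _
  rw [l1_sub_symm (quo L u) (quo L v)] at htri
  have hη1 : min m (δ / 2) ≤ m := min_le_left _ _
  have hη2 : min m (δ / 2) ≤ δ / 2 := min_le_right _ _
  have hη0 : 0 ≤ min m (δ / 2) := le_min hm (by linarith)
  have h1 := l1_nonneg (quo L v - c)
  have h3 := l1_nonneg (quo L v - quo L u)
  have f1 := mul_le_mul_of_nonneg_left htri hη0
  have f2 := mul_le_mul_of_nonneg_right hη1 h1
  have f3 := mul_le_mul_of_nonneg_right hη2 h3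
  have f4 := mul_le_mul_of_nonneg_left hq (by linarith : (0 : ℝ) ≤ δ / 2)
  nlinarith [f1, f2, f3, f4]

/-- [folklore] The two-rate summand is summable (dominated by the fine decay alone). -/
theorem summable_two_rate {L : ℕ} {m δ : ℝ} (hm : 0 ≤ m) (hδ : 0 < δ) (u c : Fin (d + 1) → ℤ) :
    Summable fun v : Fin (d + 1) → ℤ => Real.exp (-m * l1 (quo L v - c)) * Real.exp (-δ * l1 (v - u)) := by
  refine Summable.of_nonneg_of_le (fun v => by positivity) (fun v => ?_) (summable_exp_shift' hδ u)
  have h1 : Real.exp (-m * l1 (quo L v - c)) ≤ 1 := Real.exp_le_one_iff.2 (by nlinarith [l1_nonneg (quo L v - c)])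
  calc Real.exp (-m * l1 (quo L v - c)) * Real.exp (-δ * l1 (v - u))
      ≤ 1 * Real.exp (-δ * l1 (v - u)) := mul_le_mul_of_nonneg_right h1 (Real.exp_pos _).le
    _ = Real.exp (-δ * l1 (v - u)) := one_mul _

/-- [folklore] **THE TWO-RATE SUM**: `Σ'_v e^{−m|quo L v − c|₁}·e^{−δ|v − u|₁} ≤ Zl_{d+1}(δ/2)·e^{−η|quo L u − c|₁}`, `η = min m (δ/2)` —
the sum is taken at the TABLE's rate (`ExpKernelCalculus.tsum_exp_shift'`), the constant is free of `L` and of `m`. -/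
theorem tsum_two_rate_le {L : ℕ} (hL : 1 ≤ L) {m δ : ℝ} (hm : 0 ≤ m) (hδ : 0 < δ) (u c : Fin (d + 1) → ℤ) :
    ∑' v : Fin (d + 1) → ℤ, Real.exp (-m * l1 (quo L v - c)) * Real.exp (-δ * l1 (v - u))
      ≤ Zl (d + 1) (δ / 2) * Real.exp (-(min m (δ / 2)) * l1 (quo L u - c)) := by
  have hδ2 : 0 < δ / 2 := by linarith
  calc ∑' v : Fin (d + 1) → ℤ, Real.exp (-m * l1 (quo L v - c)) * Real.exp (-δ * l1 (v - u))
      ≤ ∑' v : Fin (d + 1) → ℤ, Real.exp (-(δ / 2) * l1 (v - u)) * Real.exp (-(min m (δ / 2)) * l1 (quo L u - c)) :=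
        Summable.tsum_le_tsum (fun v => exp_two_rate_le hL hm hδ.le v u c) (summable_two_rate hm hδ u c)
          ((summable_exp_shift' hδ2 u).mul_right _)
    _ = Zl (d + 1) (δ / 2) * Real.exp (-(min m (δ / 2)) * l1 (quo L u - c)) := by
        rw [tsum_mul_right, tsum_exp_shift']

/-! ## §3 A leg against a kernel: swap the two sums, then the two-rate sum -/

/-- [folklore] The block-label leg `x ↦ e^{−m|quo L x − c|₁}` is summable on the fine lattice (leaf-04's `summable_comp_quo`). -/
theorem summable_leg {L : ℕ} (hL : 1 ≤ L) {m : ℝ} (hm : 0 < m) (c : Fin (d + 1) → ℤ) :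
    Summable fun x : Fin (d + 1) → ℤ => Real.exp (-m * l1 (quo L x - c)) := by
  haveI : NeZero L := ⟨by omega⟩
  exact summable_comp_quo (N := L) (g := fun q : Fin (d + 1) → ℤ => Real.exp (-m * l1 (q - c))) (summable_exp_shift' hm c)

/-- [folklore] **LEG AGAINST KERNEL** (the swap brick of the marginal transport): if `|F x| ≤ A·e^{−m|quo L x − c|₁}·Σ'_u ψ u·e^{−δ|x − u|₁}`
with `ψ ≥ 0` summable, `A ≥ 0`, then `|Σ'_x F x| ≤ A·Zl_{d+1}(δ/2)·Σ'_u ψ u·e^{−η|quo L u − c|₁}`, `η = min m (δ/2)`.  The leg enters by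
its SUP `A` and its block label only; the `x`-sum is paid by the kernel's fine decay (`tsum_two_rate_le`) after the swap
`KernelWard.tsum_comm_of_prodBound` (product majorant: drop `e^{−δ|x − u|₁} ≤ 1`). -/
theorem abs_tsum_leg_le {L : ℕ} (hL : 1 ≤ L) {m δ A : ℝ} (hm : 0 < m) (hδ : 0 < δ) (hA : 0 ≤ A)
    {ψ : (Fin (d + 1) → ℤ) → ℝ} (hψ0 : ∀ u, 0 ≤ ψ u) (hψ : Summable ψ) (c : Fin (d + 1) → ℤ)
    {F : (Fin (d + 1) → ℤ) → ℝ}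
    (hF : ∀ x, |F x| ≤ A * Real.exp (-m * l1 (quo L x - c)) * ∑' u, ψ u * Real.exp (-δ * l1 (x - u))) :
    |∑' x, F x| ≤ A * Zl (d + 1) (δ / 2) * ∑' u, ψ u * Real.exp (-(min m (δ / 2)) * l1 (quo L u - c)) := by
  have hle1 : ∀ x u : Fin (d + 1) → ℤ, ψ u * Real.exp (-δ * l1 (x - u)) ≤ ψ u := fun x u =>
    mul_le_of_le_one_right (hψ0 u) (Real.exp_le_one_iff.2 (by nlinarith [l1_nonneg (x - u), hδ.le]))
  have hin : ∀ x, Summable fun u => ψ u * Real.exp (-δ * l1 (x - u)) := fun x =>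
    Summable.of_nonneg_of_le (fun u => mul_nonneg (hψ0 u) (Real.exp_pos _).le) (hle1 x) hψ
  have hin_le : ∀ x, ∑' u, ψ u * Real.exp (-δ * l1 (x - u)) ≤ ∑' u, ψ u := fun x =>
    Summable.tsum_le_tsum (hle1 x) (hin x) hψ
  have hin0 : ∀ x, 0 ≤ ∑' u, ψ u * Real.exp (-δ * l1 (x - u)) := fun x =>
    tsum_nonneg fun u => mul_nonneg (hψ0 u) (Real.exp_pos _).le
  have hleg := summable_leg (d := d) hL hm c
  -- the majorant and its summability
  have hMs : Summable fun x : Fin (d + 1) → ℤ =>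
      A * Real.exp (-m * l1 (quo L x - c)) * ∑' u, ψ u * Real.exp (-δ * l1 (x - u)) := by
    refine Summable.of_nonneg_of_le (fun x => mul_nonneg (mul_nonneg hA (Real.exp_pos _).le) (hin0 x))
      (fun x => mul_le_mul_of_nonneg_left (hin_le x) (mul_nonneg hA (Real.exp_pos _).le))
      ((hleg.mul_left A).mul_right (∑' u, ψ u))
  have h1 : |∑' x, F x| ≤ ∑' x, A * Real.exp (-m * l1 (quo L x - c)) * ∑' u, ψ u * Real.exp (-δ * l1 (x - u)) := by
    have h := tsum_of_norm_bounded hMs.hasSum (fun x => by rw [Real.norm_eq_abs]; exact hF x)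
    rwa [Real.norm_eq_abs] at h
  refine h1.trans ?_
  -- swap the two sums
  have hG : ProdBound (fun (x u : Fin (d + 1) → ℤ) => Real.exp (-m * l1 (quo L x - c)) * (ψ u * Real.exp (-δ * l1 (x - u)))) := by
    refine ⟨fun x => Real.exp (-m * l1 (quo L x - c)), ψ, hleg, hψ, fun x => (Real.exp_pos _).le, hψ0, fun x u => ?_⟩
    rw [abs_of_nonneg (mul_nonneg (Real.exp_pos _).le (mul_nonneg (hψ0 u) (Real.exp_pos _).le))]
    exact mul_le_mul_of_nonneg_left (hle1 x u) (Real.exp_pos _).le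
  have h2 : (∑' x, A * Real.exp (-m * l1 (quo L x - c)) * ∑' u, ψ u * Real.exp (-δ * l1 (x - u)))
      = A * ∑' u, ψ u * ∑' x, Real.exp (-m * l1 (quo L x - c)) * Real.exp (-δ * l1 (x - u)) := by
    calc (∑' x, A * Real.exp (-m * l1 (quo L x - c)) * ∑' u, ψ u * Real.exp (-δ * l1 (x - u)))
        = ∑' x, A * ∑' u, Real.exp (-m * l1 (quo L x - c)) * (ψ u * Real.exp (-δ * l1 (x - u))) := by
          refine tsum_congr fun x => ?_
          rw [mul_assoc, ← tsum_mul_left]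
      _ = A * ∑' x, ∑' u, Real.exp (-m * l1 (quo L x - c)) * (ψ u * Real.exp (-δ * l1 (x - u))) := tsum_mul_left
      _ = A * ∑' u, ∑' x, Real.exp (-m * l1 (quo L x - c)) * (ψ u * Real.exp (-δ * l1 (x - u))) := by
          rw [tsum_comm_of_prodBound hG]
      _ = A * ∑' u, ψ u * ∑' x, Real.exp (-m * l1 (quo L x - c)) * Real.exp (-δ * l1 (x - u)) := by
          congr 1
          refine tsum_congr fun u => ?_
          rw [← tsum_mul_left]
          exact tsum_congr fun x => by ring
  rw [h2, mul_assoc]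
  refine mul_le_mul_of_nonneg_left ?_ hA
  -- per `u`: the two-rate sum
  have h4 : ∀ u, ψ u * ∑' x, Real.exp (-m * l1 (quo L x - c)) * Real.exp (-δ * l1 (x - u))
      ≤ ψ u * (Zl (d + 1) (δ / 2) * Real.exp (-(min m (δ / 2)) * l1 (quo L u - c))) := fun u =>
    mul_le_mul_of_nonneg_left (tsum_two_rate_le hL hm.le hδ u c) (hψ0 u)
  have hZ : 0 ≤ Zl (d + 1) (δ / 2) := Zl_nonneg (by linarith)
  have hR : Summable fun u => ψ u * (Zl (d + 1) (δ / 2) * Real.exp (-(min m (δ / 2)) * l1 (quo L u - c))) := by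
    refine Summable.of_nonneg_of_le (fun u => mul_nonneg (hψ0 u) (mul_nonneg hZ (Real.exp_pos _).le)) (fun u => ?_)
      (hψ.mul_right (Zl (d + 1) (δ / 2)))
    refine mul_le_mul_of_nonneg_left ?_ (hψ0 u)
    have hη0 : 0 ≤ min m (δ / 2) := le_min hm.le (by linarith)
    exact mul_le_of_le_one_right hZ (Real.exp_le_one_iff.2 (by nlinarith [l1_nonneg (quo L u - c)]))
  have hLs : Summable fun u => ψ u * ∑' x, Real.exp (-m * l1 (quo L x - c)) * Real.exp (-δ * l1 (x - u)) :=
    Summable.of_nonneg_of_le (fun u => mul_nonneg (hψ0 u) (tsum_nonneg fun x => by positivity)) h4 hR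
  calc ∑' u, ψ u * ∑' x, Real.exp (-m * l1 (quo L x - c)) * Real.exp (-δ * l1 (x - u))
      ≤ ∑' u, ψ u * (Zl (d + 1) (δ / 2) * Real.exp (-(min m (δ / 2)) * l1 (quo L u - c))) :=
        Summable.tsum_le_tsum h4 hLs hR
    _ = Zl (d + 1) (δ / 2) * ∑' u, ψ u * Real.exp (-(min m (δ / 2)) * l1 (quo L u - c)) := by
        rw [← tsum_mul_left]; exact tsum_congr fun u => by ring

/-! ## §4 The one free block sum -/

/-- [folklore] **FOUR FACTORS AT ONE BLOCK LABEL, POINTWISE**: with `τ := min (m/4) η`, `0 ≤ η`, `0 ≤ m`,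
`e^{−m|q − y|₁}·e^{−η|q − y′|₁}·e^{−η|q − x′|₁}·e^{−η|q − z′|₁} ≤ e^{−(m/4)|q − y|₁}·(e^{−τ|y′ − y|₁}·e^{−τ(|x′ − y|₁ + |z′ − y|₁)})`
(a quarter of the first leg is kept for the block sum; each other quarter joins one of the three factors through the triangle inequality). -/
theorem exp_four_le {m η : ℝ} (hm : 0 ≤ m) (hη : 0 ≤ η) (q y y' x' z' : Fin (d + 1) → ℤ) :
    Real.exp (-m * l1 (q - y)) * Real.exp (-η * l1 (q - y')) * Real.exp (-η * l1 (q - x')) * Real.exp (-η * l1 (q - z'))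
      ≤ Real.exp (-(m / 4) * l1 (q - y)) *
          (Real.exp (-(min (m / 4) η) * l1 (y' - y)) * Real.exp (-(min (m / 4) η) * (l1 (x' - y) + l1 (z' - y)))) := by
  rw [← Real.exp_add, ← Real.exp_add, ← Real.exp_add, ← Real.exp_add, ← Real.exp_add, Real.exp_le_exp]
  have t1 : l1 (y' - y) ≤ l1 (y' - q) + l1 (q - y) := l1_sub_triangle _ _ _
  have t2 : l1 (x' - y) ≤ l1 (x' - q) + l1 (q - y) := l1_sub_triangle _ _ _
  have t3 : l1 (z' - y) ≤ l1 (z' - q) + l1 (q - y) := l1_sub_triangle _ _ _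
  rw [l1_sub_symm y' q] at t1
  rw [l1_sub_symm x' q] at t2
  rw [l1_sub_symm z' q] at t3
  have hτ0 : 0 ≤ min (m / 4) η := le_min (by linarith) hη
  have hτ1 : min (m / 4) η ≤ m / 4 := min_le_left _ _
  have hτ2 : min (m / 4) η ≤ η := min_le_right _ _
  have a0 := l1_nonneg (q - y)
  have a1 := l1_nonneg (q - y')
  have a2 := l1_nonneg (q - x')
  have a3 := l1_nonneg (q - z')
  have f1 := mul_le_mul_of_nonneg_left t1 hτ0
  have f2 := mul_le_mul_of_nonneg_left t2 hτ0
  have f3 := mul_le_mul_of_nonneg_left t3 hτ0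
  have g0 := mul_le_mul_of_nonneg_right hτ1 a0
  have g1 := mul_le_mul_of_nonneg_right hτ2 a1
  have g2 := mul_le_mul_of_nonneg_right hτ2 a2
  have g3 := mul_le_mul_of_nonneg_right hτ2 a3
  nlinarith [f1, f2, f3, g0, g1, g2, g3]

/-- [folklore] The four-factor summand is summable (dominated by the first leg alone). -/
theorem summable_four {L : ℕ} (hL : 1 ≤ L) {m η : ℝ} (hm : 0 < m) (hη : 0 ≤ η) (y y' x' z' : Fin (d + 1) → ℤ) :
    Summable fun u : Fin (d + 1) → ℤ =>
      Real.exp (-m * l1 (quo L u - y)) * Real.exp (-η * l1 (quo L u - y')) * Real.exp (-η * l1 (quo L u - x')) *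
        Real.exp (-η * l1 (quo L u - z')) := by
  refine Summable.of_nonneg_of_le (fun u => by positivity) (fun u => ?_) (summable_leg (d := d) hL hm y)
  have e1 : Real.exp (-η * l1 (quo L u - y')) ≤ 1 := Real.exp_le_one_iff.2 (by nlinarith [l1_nonneg (quo L u - y')])
  have e2 : Real.exp (-η * l1 (quo L u - x')) ≤ 1 := Real.exp_le_one_iff.2 (by nlinarith [l1_nonneg (quo L u - x')])
  have e3 : Real.exp (-η * l1 (quo L u - z')) ≤ 1 := Real.exp_le_one_iff.2 (by nlinarith [l1_nonneg (quo L u - z')])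
  have p0 := Real.exp_pos (-m * l1 (quo L u - y))
  have p1 := Real.exp_pos (-η * l1 (quo L u - y'))
  have p2 := Real.exp_pos (-η * l1 (quo L u - x'))
  calc Real.exp (-m * l1 (quo L u - y)) * Real.exp (-η * l1 (quo L u - y')) * Real.exp (-η * l1 (quo L u - x')) *
        Real.exp (-η * l1 (quo L u - z'))
      ≤ Real.exp (-m * l1 (quo L u - y)) * 1 * 1 * 1 := by
        gcongr
    _ = Real.exp (-m * l1 (quo L u - y)) := by ring

/-- [folklore] **THE ONE FREE BLOCK SUM** (the only power of the relative blocking `L` in the marginal transport): with `τ := min (m/4) η`,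
`Σ'_u e^{−m|quo L u − y|₁}·e^{−η|quo L u − y′|₁}·e^{−η|quo L u − x′|₁}·e^{−η|quo L u − z′|₁}
  ≤ L^{d+1}·Zl_{d+1}(m/4)·(e^{−τ|y′ − y|₁}·e^{−τ(|x′ − y|₁ + |z′ − y|₁)})` — `exp_four_le` pointwise, then leaf-04's `tsum_comp_quo`
(each block of the fine lattice has `L^{d+1}` points) and `ExpKernelCalculus.tsum_exp_shift'`. -/
theorem tsum_block_four_le {L : ℕ} (hL : 1 ≤ L) {m η : ℝ} (hm : 0 < m) (hη : 0 ≤ η) (y y' x' z' : Fin (d + 1) → ℤ) :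
    ∑' u : Fin (d + 1) → ℤ,
        Real.exp (-m * l1 (quo L u - y)) * Real.exp (-η * l1 (quo L u - y')) * Real.exp (-η * l1 (quo L u - x')) *
          Real.exp (-η * l1 (quo L u - z'))
      ≤ (L : ℝ) ^ (d + 1) * Zl (d + 1) (m / 4) *
          (Real.exp (-(min (m / 4) η) * l1 (y' - y)) * Real.exp (-(min (m / 4) η) * (l1 (x' - y) + l1 (z' - y)))) := by
  haveI : NeZero L := ⟨by omega⟩
  have hm4 : 0 < m / 4 := by linarith
  have hq : Summable fun q : Fin (d + 1) → ℤ => Real.exp (-(m / 4) * l1 (q - y)) := summable_exp_shift' hm4 y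
  have hs : Summable fun u : Fin (d + 1) → ℤ => Real.exp (-(m / 4) * l1 (quo L u - y)) :=
    summable_comp_quo (N := L) (g := fun q : Fin (d + 1) → ℤ => Real.exp (-(m / 4) * l1 (q - y))) hq
  calc ∑' u : Fin (d + 1) → ℤ,
        Real.exp (-m * l1 (quo L u - y)) * Real.exp (-η * l1 (quo L u - y')) * Real.exp (-η * l1 (quo L u - x')) *
          Real.exp (-η * l1 (quo L u - z'))
      ≤ ∑' u : Fin (d + 1) → ℤ, Real.exp (-(m / 4) * l1 (quo L u - y)) *
          (Real.exp (-(min (m / 4) η) * l1 (y' - y)) * Real.exp (-(min (m / 4) η) * (l1 (x' - y) + l1 (z' - y)))) :=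
        Summable.tsum_le_tsum (fun u => exp_four_le hm.le hη (quo L u) y y' x' z') (summable_four hL hm hη y y' x' z')
          (hs.mul_right _)
    _ = (L : ℝ) ^ (d + 1) * Zl (d + 1) (m / 4) *
          (Real.exp (-(min (m / 4) η) * l1 (y' - y)) * Real.exp (-(min (m / 4) η) * (l1 (x' - y) + l1 (z' - y)))) := by
        rw [tsum_mul_right, tsum_comp_quo (N := L) (g := fun q : Fin (d + 1) → ℤ => Real.exp (-(m / 4) * l1 (q - y))) hq,
          tsum_exp_shift']

end Summit.QuantumFields.BalabanUV.Beta.GAN24.Push4TwoRate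

end
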